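import Literature.ComputerArithmetic.JeannerodRump2018.Summation
import Mathlib.Tactic.FieldSimp
import Mathlib.Tactic.Linarith
import Mathlib.Tactic.Positivity
import Mathlib.Tactic.Ring
import Mathlib.Tactic.NormNum

/-!
# The stage-B margins at the ATTAINED estimate error: Table 3 and Table 5, line B

Shared numerical engines serving client cells; rigour lives in the verifiers; every published number
belongs to a client cell's ledger, not to the engines group.  NEW WORK of this development (pure
inequalities between rationals; nothing is claimed about the C code `predicates.c`).

CONTEXT.  The stage-B soundness theorems of `Orient3dStageBBounds.lean` and
`IncircleStageBBounds.lean` need, for the errbound coefficient `K` and a UNIFORM relative error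
bound `δ` of ESTIMATE on the stage-B expansion (`|B′ − B| ≤ δ|B|`), the margins
  (MB₃)  `(1 + δ)(3ε + 6ε² + 4ε³ + ε⁴) < (1 − ε)⁵·K`                       (ORIENT3D),
  (MB₄)  `(1 + δ)(4ε + 18ε² + 34ε³ + 35ε⁴ + 21ε⁵ + 7ε⁶ + ε⁷) < (1 − ε)⁵·K`  (INCIRCLE),
`ε = u = 2^−p`.  `Orient3dStageBMargins.lean` / `IncircleStageBMargins.lean` evaluate them at the
PROVED `δ = 3ε` (certifying `(3 + 32ε)ε`, `p ≥ 7`, and `(4 + 56ε)ε`, `p ≥ 6`) and at the paper's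
`δ = 2ε` (which would certify Shewchuk's printed `(3 + 28ε)ε` and `(4 + 48ε)ε`), and record that the
printed coefficients close the margins only for `δ = kε` with `k ≤ 7/3`, resp. `k < 5/2`, to leading
order.  `EstimateUlpCounterexample.lean` then exhibited, for EVERY precision `p ≥ 4`, a strongly
(and weakly) nonoverlapping expansion `⟨1, −(2^(p+1) − 4), −2^(p+2), 2^(p+3)⟩` on which ESTIMATE
with round-to-nearest-even errs by exactly `5` for a sum `2^(p+1) + 5`: relative error
`5/(2^(p+1) + 5) = 5ε/(2 + 5ε)` (`attainedEstimateError`, `attainedEstimateError_eq`).  Consequently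
every `δ` that is valid uniformly on strongly — a fortiori weakly — nonoverlapping expansions under
round-to-nearest-even satisfies `δ ≥ 5ε/(2 + 5ε)`; and the left sides of (MB₃), (MB₄) increase
with `δ`.

THE RESULTS (exact polynomial identities, `ring`; signs by grouping, `0 < ε ≤ 1/2`).
* `o3derrboundB_margin_fails_attained`: for `0 < ε ≤ 1/2` and every `δ ≥ 5ε/(2 + 5ε)`, (MB₃) FAILS
  for `K = (3 + 28ε)ε` — indeed
  `(2 + 5ε)·[(1 − ε)⁵(3 + 28ε)ε − (1 + 5ε/(2+5ε))(3ε + 6ε² + 4ε³ + ε⁴)]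
  = −ε²(1 + 223ε + 92ε² − 710ε³ + 1051ε⁴ − 629ε⁵ + 140ε⁶) < 0`.
* `iccerrboundB_margin_fails_attained`: likewise (MB₄) FAILS for `K = (4 + 48ε)ε`, the bracket
  being `−ε³(508 + 530ε − 888ε² + 2052ε³ − 1012ε⁴ + 250ε⁵) < 0`.
* `…_unitRoundoff` versions: at `ε = unitRoundoff p`, every `p ≥ 1`, every
  `δ ≥ attainedEstimateError p`.
So, GIVEN the attained error, the printed line-B coefficients of Table 3 (`(3 + 28ε)ε`, p. 351) and
Table 5 (`(4 + 48ε)ε`, p. 352) are out of reach of the stage-B margin arguments of this development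
at every precision, whatever uniform estimate bound is eventually proved: for ORIENT3D the leading
coefficient `7 − 3k` is already negative at `k = 5/(2 + 5ε)` when `ε < 1/35`; for INCIRCLE it is
`10 − 4k = 50ε/(2 + 5ε) > 0` but loses to the `ε³` terms (`≈ −254ε³` in all).  This settles, for
line B, the alternative left open in remark (ii) of `EstimateUlpCounterexample.lean`.

LINE C IS DIFFERENT (recorded, not adjudicated).  The stage-C margin (MR) of
`Orient3dStageCMargins.lean`, `δ < (1 − δ)(1 − ε)³·K_R`, is equivalent to
`δ < (1 − ε)³K_R / (1 + (1 − ε)³K_R)` (`marginR_iff`), which for Shewchuk's `K_R = (3 + 8ε)ε` is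
`(3 − 10ε + O(ε²))ε`: it tolerates every `δ ≤ 5ε/2` from `p ≥ 5` on
(`resulterrbound_margin_of_le_five_halves`, polynomial `1 − 17ε − 25ε² + 117ε³ − 121ε⁴ + 40ε⁵ > 0`
on `0 < ε ≤ 1/32`), in particular the attained `5ε/(2 + 5ε)`.  Whether the printed line-C
coefficients are certified by that analysis therefore depends only on the OPEN question of the
worst relative error of ESTIMATE on weakly nonoverlapping expansions under round-to-nearest-even,
known to lie in `[5ε/(2 + 5ε), 3ε]` (`EstimateUlpCounterexample`, `EstimateRelativeError`); any
proved uniform bound below `(3 − 10ε)ε`, e.g. `5ε/2`, would certify them for binary64.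

A failed margin is a gap in a sufficient condition of OUR analysis, not an input on which
`predicates.c` errs; we know of none.  References: J. R. Shewchuk, Discrete Comput. Geom. 18 (1997)
305–363, §4.3 p. 349, §4.4 Table 3 p. 351, §4.5 Table 5 p. 352; `predicates.c` (`exactinit`)
[Shewchuk1997].
-/

namespace Summit.Ventures.CertifiedArithmetic.Expansions

open Literature.ComputerArithmetic.JeannerodRump2018

/-! ## The attained relative error of ESTIMATE -/

/-- The relative error `5ε/(2 + 5ε)` (`ε = 2^−p`) that ESTIMATE attains, under
round-to-nearest-even, on the strongly nonoverlapping expansion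
`⟨1, −(2^(p+1) − 4), −2^(p+2), 2^(p+3)⟩`
(`EstimateUlpCounterexample.estimate_counterexample_family`: error `5`, sum `2^(p+1) + 5`). -/
def attainedEstimateError (p : ℕ) : ℚ := 5 * unitRoundoff p / (2 + 5 * unitRoundoff p)

/-- `5/(2^(p+1) + 5) = 5ε/(2 + 5ε)`: the error-to-sum ratio of the counterexample family IS
`attainedEstimateError p`. -/
theorem attainedEstimateError_eq (p : ℕ) :
    5 / ((2 : ℚ) ^ (p + 1) + 5) = attainedEstimateError p := by
  unfold attainedEstimateError unitRoundoff
  have h2 : (0 : ℚ) < 2 ^ p := by positivity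
  field_simp
  ring

/-- `0 < 5ε/(2 + 5ε)`. -/
theorem attainedEstimateError_pos (p : ℕ) : 0 < attainedEstimateError p := by
  unfold attainedEstimateError unitRoundoff
  positivity

/-- `5ε/(2 + 5ε) < 5ε/2`: the attained error lies below `5ε/2` (and above `2ε` once `p ≥ 2`). -/
theorem attainedEstimateError_lt_five_halves (p : ℕ) :
    attainedEstimateError p < 5 * unitRoundoff p / 2 := by
  unfold attainedEstimateError
  have hu : 0 < unitRoundoff p := by unfold unitRoundoff; positivity
  rw [div_lt_div_iff₀ (by linarith) (by norm_num : (0 : ℚ) < 2)]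
  nlinarith

/-! ## Line B of Table 3 (ORIENT3D): `(3 + 28ε)ε` fails (MB₃) at every admissible `δ` -/

/-- (MB₃) REVERSED, strictly, for Shewchuk's `K = (3 + 28ε)ε` as soon as `δ ≥ 5ε/(2 + 5ε)`
(`0 < ε ≤ 1/2`): `(2 + 5ε)` times the margin at `δ = 5ε/(2+5ε)` is
`−ε²(1 + 223ε + 92ε² − 710ε³ + 1051ε⁴ − 629ε⁵ + 140ε⁶)`, and the left side grows with `δ`. -/
theorem o3derrboundB_margin_fails_attained {u δ : ℚ} (hu0 : 0 < u) (hu : u ≤ 1 / 2)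
    (hδ : 5 * u / (2 + 5 * u) ≤ δ) :
    (1 - u) ^ 5 * ((3 + 28 * u) * u) < (1 + δ) * (3 * u + 6 * u ^ 2 + 4 * u ^ 3 + u ^ 4) := by
  have hbase : 0 < 3 * u + 6 * u ^ 2 + 4 * u ^ 3 + u ^ 4 := by positivity
  have h25 : 0 < 2 + 5 * u := by linarith
  -- the margin at the attained error, cleared of its denominator
  have hkey : (2 + 10 * u) * (3 * u + 6 * u ^ 2 + 4 * u ^ 3 + u ^ 4)
      - (2 + 5 * u) * ((1 - u) ^ 5 * ((3 + 28 * u) * u))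
      = u ^ 2 * (1 + 223 * u + 92 * u ^ 2 - 710 * u ^ 3 + 1051 * u ^ 4 - 629 * u ^ 5
        + 140 * u ^ 6) := by
    ring
  have hbr : 0 < 1 + 223 * u + 92 * u ^ 2 - 710 * u ^ 3 + 1051 * u ^ 4 - 629 * u ^ 5
      + 140 * u ^ 6 := by
    have h1 : 0 ≤ 223 * u - 710 * u ^ 3 := by
      have h : 0 ≤ 223 - 710 * u ^ 2 := by nlinarith
      nlinarith
    have h2 : 0 ≤ 1051 * u ^ 4 - 629 * u ^ 5 := by
      have h : 0 ≤ 1051 - 629 * u := by linarith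
      have h4 : 0 ≤ u ^ 4 := by positivity
      nlinarith
    nlinarith [sq_nonneg u, pow_nonneg hu0.le 6]
  have hatt : (2 + 5 * u) * ((1 - u) ^ 5 * ((3 + 28 * u) * u))
      < (2 + 10 * u) * (3 * u + 6 * u ^ 2 + 4 * u ^ 3 + u ^ 4) := by
    have : 0 < u ^ 2 * (1 + 223 * u + 92 * u ^ 2 - 710 * u ^ 3 + 1051 * u ^ 4 - 629 * u ^ 5
        + 140 * u ^ 6) := by positivity
    linarith
  -- `1 + δ ≥ 1 + 5u/(2+5u) = (2 + 10u)/(2 + 5u)`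
  have hmono : (2 + 10 * u) / (2 + 5 * u) * (3 * u + 6 * u ^ 2 + 4 * u ^ 3 + u ^ 4)
      ≤ (1 + δ) * (3 * u + 6 * u ^ 2 + 4 * u ^ 3 + u ^ 4) := by
    apply mul_le_mul_of_nonneg_right _ hbase.le
    have : (2 + 10 * u) / (2 + 5 * u) = 1 + 5 * u / (2 + 5 * u) := by
      field_simp; ring
    linarith
  calc (1 - u) ^ 5 * ((3 + 28 * u) * u)
      < (2 + 10 * u) / (2 + 5 * u) * (3 * u + 6 * u ^ 2 + 4 * u ^ 3 + u ^ 4) := by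
        rw [div_mul_eq_mul_div, lt_div_iff₀ h25]
        linarith
    _ ≤ (1 + δ) * (3 * u + 6 * u ^ 2 + 4 * u ^ 3 + u ^ 4) := hmono

/-- Hence (MB₃) with `K = o3derrboundB p = (3 + 28ε)ε` is FALSE at `ε = unitRoundoff p`, for every
precision `p ≥ 1` and every estimate bound `δ ≥ attainedEstimateError p`. -/
theorem o3derrboundB_margin_fails_attained_unitRoundoff {p : ℕ} (hp : 1 ≤ p) {δ : ℚ}
    (hδ : attainedEstimateError p ≤ δ) :
    ¬ ((1 + δ) * (3 * unitRoundoff p + 6 * unitRoundoff p ^ 2 + 4 * unitRoundoff p ^ 3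
        + unitRoundoff p ^ 4) < (1 - unitRoundoff p) ^ 5 * ((3 + 28 * unitRoundoff p)
        * unitRoundoff p)) := by
  have hu0 : 0 < unitRoundoff p := by unfold unitRoundoff; positivity
  have hu : unitRoundoff p ≤ 1 / 2 := by
    unfold unitRoundoff
    have h : (2 : ℚ) ≤ 2 ^ p := by
      calc (2 : ℚ) = 2 ^ 1 := by norm_num
        _ ≤ 2 ^ p := pow_le_pow_right₀ (by norm_num) hp
    exact one_div_le_one_div_of_le (by norm_num) h
  exact not_lt.mpr (o3derrboundB_margin_fails_attained hu0 hu hδ).le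

/-! ## Line B of Table 5 (INCIRCLE): `(4 + 48ε)ε` fails (MB₄) at every admissible `δ` -/

/-- (MB₄) REVERSED, strictly, for Shewchuk's `K = (4 + 48ε)ε` as soon as `δ ≥ 5ε/(2 + 5ε)`
(`0 < ε ≤ 1/2`): `(2 + 5ε)` times the margin at `δ = 5ε/(2+5ε)` is
`−ε³(508 + 530ε − 888ε² + 2052ε³ − 1012ε⁴ + 250ε⁵)`; the leading order `ε²(10 − 4k)` of
`IncircleStageBMargins` is positive here (`k = 5/(2+5ε) < 5/2`) but of size `25ε³` only. -/
theorem iccerrboundB_margin_fails_attained {u δ : ℚ} (hu0 : 0 < u) (hu : u ≤ 1 / 2)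
    (hδ : 5 * u / (2 + 5 * u) ≤ δ) :
    (1 - u) ^ 5 * ((4 + 48 * u) * u) < (1 + δ) * (4 * u + 18 * u ^ 2 + 34 * u ^ 3 + 35 * u ^ 4
      + 21 * u ^ 5 + 7 * u ^ 6 + u ^ 7) := by
  have hbase : 0 < 4 * u + 18 * u ^ 2 + 34 * u ^ 3 + 35 * u ^ 4 + 21 * u ^ 5 + 7 * u ^ 6
      + u ^ 7 := by positivity
  have h25 : 0 < 2 + 5 * u := by linarith
  have hkey : (2 + 10 * u) * (4 * u + 18 * u ^ 2 + 34 * u ^ 3 + 35 * u ^ 4 + 21 * u ^ 5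
      + 7 * u ^ 6 + u ^ 7) - (2 + 5 * u) * ((1 - u) ^ 5 * ((4 + 48 * u) * u))
      = u ^ 3 * (508 + 530 * u - 888 * u ^ 2 + 2052 * u ^ 3 - 1012 * u ^ 4 + 250 * u ^ 5) := by
    ring
  have hbr : 0 < 508 + 530 * u - 888 * u ^ 2 + 2052 * u ^ 3 - 1012 * u ^ 4 + 250 * u ^ 5 := by
    have h1 : 0 ≤ 530 * u - 888 * u ^ 2 := by
      have h : 0 ≤ 530 - 888 * u := by linarith
      nlinarith
    have h2 : 0 ≤ 2052 * u ^ 3 - 1012 * u ^ 4 := by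
      have h : 0 ≤ 2052 - 1012 * u := by linarith
      have h3 : 0 ≤ u ^ 3 := by positivity
      nlinarith
    nlinarith [pow_nonneg hu0.le 5]
  have hatt : (2 + 5 * u) * ((1 - u) ^ 5 * ((4 + 48 * u) * u))
      < (2 + 10 * u) * (4 * u + 18 * u ^ 2 + 34 * u ^ 3 + 35 * u ^ 4 + 21 * u ^ 5 + 7 * u ^ 6
        + u ^ 7) := by
    have : 0 < u ^ 3 * (508 + 530 * u - 888 * u ^ 2 + 2052 * u ^ 3 - 1012 * u ^ 4
        + 250 * u ^ 5) := by positivity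
    linarith
  have hmono : (2 + 10 * u) / (2 + 5 * u) * (4 * u + 18 * u ^ 2 + 34 * u ^ 3 + 35 * u ^ 4
      + 21 * u ^ 5 + 7 * u ^ 6 + u ^ 7) ≤ (1 + δ) * (4 * u + 18 * u ^ 2 + 34 * u ^ 3
      + 35 * u ^ 4 + 21 * u ^ 5 + 7 * u ^ 6 + u ^ 7) := by
    apply mul_le_mul_of_nonneg_right _ hbase.le
    have : (2 + 10 * u) / (2 + 5 * u) = 1 + 5 * u / (2 + 5 * u) := by
      field_simp; ring
    linarith
  calc (1 - u) ^ 5 * ((4 + 48 * u) * u)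
      < (2 + 10 * u) / (2 + 5 * u) * (4 * u + 18 * u ^ 2 + 34 * u ^ 3 + 35 * u ^ 4
          + 21 * u ^ 5 + 7 * u ^ 6 + u ^ 7) := by
        rw [div_mul_eq_mul_div, lt_div_iff₀ h25]
        linarith
    _ ≤ _ := hmono

/-- Hence (MB₄) with `K = iccerrboundB p = (4 + 48ε)ε` is FALSE at `ε = unitRoundoff p`, for every
precision `p ≥ 1` and every estimate bound `δ ≥ attainedEstimateError p`. -/
theorem iccerrboundB_margin_fails_attained_unitRoundoff {p : ℕ} (hp : 1 ≤ p) {δ : ℚ}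
    (hδ : attainedEstimateError p ≤ δ) :
    ¬ ((1 + δ) * (4 * unitRoundoff p + 18 * unitRoundoff p ^ 2 + 34 * unitRoundoff p ^ 3
        + 35 * unitRoundoff p ^ 4 + 21 * unitRoundoff p ^ 5 + 7 * unitRoundoff p ^ 6
        + unitRoundoff p ^ 7) < (1 - unitRoundoff p) ^ 5 * ((4 + 48 * unitRoundoff p)
        * unitRoundoff p)) := by
  have hu0 : 0 < unitRoundoff p := by unfold unitRoundoff; positivity
  have hu : unitRoundoff p ≤ 1 / 2 := by
    unfold unitRoundoff
    have h : (2 : ℚ) ≤ 2 ^ p := by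
      calc (2 : ℚ) = 2 ^ 1 := by norm_num
        _ ≤ 2 ^ p := pow_le_pow_right₀ (by norm_num) hp
    exact one_div_le_one_div_of_le (by norm_num) h
  exact not_lt.mpr (iccerrboundB_margin_fails_attained hu0 hu hδ).le

/-! ## Line C: the stage-C margin (MR) tolerates every `δ ≤ 5ε/2` from `p ≥ 5` -/

/-- (MR) `δ < (1 − δ)(1 − ε)³K` solved for `δ`: it says `δ < (1 − ε)³K / (1 + (1 − ε)³K)` (as soon
as the denominator is positive).  For `K = (3 + 8ε)ε` the threshold is `(3 − 10ε + O(ε²))ε`. -/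
theorem marginR_iff {u δ K : ℚ} (hK : 0 < 1 + (1 - u) ^ 3 * K) :
    δ < (1 - δ) * (1 - u) ^ 3 * K ↔ δ < (1 - u) ^ 3 * K / (1 + (1 - u) ^ 3 * K) := by
  rw [lt_div_iff₀ hK]
  constructor <;> intro h <;> nlinarith

/-- (MR) for Shewchuk's `K_R = resulterrbound = (3 + 8ε)ε` holds for EVERY `δ ≤ 5ε/2` when
`0 < ε ≤ 1/32` (`p ≥ 5`): the slack at `δ = 5ε/2` is `(ε/2)(1 − 17ε − 25ε² + 117ε³ − 121ε⁴ + 40ε⁵)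
> 0`, and the margin is monotone in `δ`.  (At `ε = 1/16` the polynomial is negative: `p ≥ 5` is
needed for `5ε/2`, cf. `Orient3dStageCMargins`; `δ = 3ε` fails at every precision, ibid.) -/
theorem resulterrbound_margin_of_le_five_halves {u δ : ℚ} (hu0 : 0 < u) (hu : u ≤ 1 / 32)
    (hδ : δ ≤ 5 * u / 2) :
    δ < (1 - δ) * (1 - u) ^ 3 * ((3 + 8 * u) * u) := by
  have hK : 0 < (1 - u) ^ 3 * ((3 + 8 * u) * u) := by
    have h1 : 0 < 1 - u := by linarith
    positivity
  have hkey : (1 - 5 * u / 2) * (1 - u) ^ 3 * ((3 + 8 * u) * u) - 5 * u / 2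
      = u / 2 * (1 - 17 * u - 25 * u ^ 2 + 117 * u ^ 3 - 121 * u ^ 4 + 40 * u ^ 5) := by
    ring
  have hbr : 0 < 1 - 17 * u - 25 * u ^ 2 + 117 * u ^ 3 - 121 * u ^ 4 + 40 * u ^ 5 := by
    have h1 : 17 * u + 25 * u ^ 2 < 1 := by nlinarith
    have h2 : 0 ≤ 117 * u ^ 3 - 121 * u ^ 4 := by
      have h : 0 ≤ 117 - 121 * u := by linarith
      have h3 : 0 ≤ u ^ 3 := by positivity
      nlinarith
    nlinarith [pow_nonneg hu0.le 5]
  have hfive : 5 * u / 2 < (1 - 5 * u / 2) * (1 - u) ^ 3 * ((3 + 8 * u) * u) := by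
    have : 0 < u / 2 * (1 - 17 * u - 25 * u ^ 2 + 117 * u ^ 3 - 121 * u ^ 4 + 40 * u ^ 5) := by
      positivity
    linarith
  -- monotonicity in `δ`: `δ ↦ δ − (1 − δ)c = δ(1 + c) − c` is increasing (`c > 0`)
  nlinarith

/-- In particular (MR) for `(3 + 8ε)ε` holds at the attained error `5ε/(2 + 5ε)` for every
`p ≥ 5`: line C is NOT excluded by `EstimateUlpCounterexample` — its certification by the analysis
of `Orient3dStageCBounds` waits only on a uniform estimate bound below `(3 − 10ε + O(ε²))ε`. -/
theorem resulterrbound_margin_attained {p : ℕ} (hp : 5 ≤ p) :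
    attainedEstimateError p < (1 - attainedEstimateError p) * (1 - unitRoundoff p) ^ 3
      * ((3 + 8 * unitRoundoff p) * unitRoundoff p) := by
  have hu0 : 0 < unitRoundoff p := by unfold unitRoundoff; positivity
  have hu : unitRoundoff p ≤ 1 / 32 := by
    unfold unitRoundoff
    have h : (32 : ℚ) ≤ 2 ^ p := by
      calc (32 : ℚ) = 2 ^ 5 := by norm_num
        _ ≤ 2 ^ p := pow_le_pow_right₀ (by norm_num) hp
    exact one_div_le_one_div_of_le (by norm_num) h
  exact resulterrbound_margin_of_le_five_halves hu0 hu (attainedEstimateError_lt_five_halves p).le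

end Summit.Ventures.CertifiedArithmetic.Expansions
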